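import Mathlib.Topology.Algebra.Group.Basic
import Literature.IUT.HodgeTheaters.TemperedCoverings
import Literature.IUT.HodgeTheaters.TemperedCoveringsProofs
import Literature.IUT.HodgeTheaters.TemperedCoveringsCor23iiiProofs
import HarnessLib

/-!
# [IUTchI] Corollary 2.3 (iii) AS TYPED: the exact sequences and centre-freeness, from (i), (ii)
# and the slimness of `Δ̂_{X,ℍ}` (kurims p. 47, proof pp. 48–49) — abc-iut cell, layer L5, PROOFS

Mochizuki, *Inter-universal Teichmüller theory I: construction of Hodge theaters*, kurims
manuscript (May 2020), §2, Corollary 2.3 (iii) p. 47 ([IUTchI] Cor 2.3(iii) p.47)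
[claim: Mochizuki2012, status: disputed] (D-0012 claim key; series status DISPUTED).  PROOF-ONLY
companion of `Literature.IUT.HodgeTheaters.TemperedCoverings` (abc-iut-L5-t1): no new definitions,
nothing printed is asserted outright.  DAG node `IUTchI:Cor2.3(iii)` (cone of [IUTchIII] Cor 3.12).

What print says (p. 47): "Suppose (a) or (b).  Then `Δ̂_{X,ℍ}` is slim.  In particular, the natural
outer actions of `G_k` on `Δ^tp_{X,ℍ}`, `Δ̂_{X,ℍ}` [cf. (i)] determine natural exact sequences of
center-free topological groups [cf. (ii); the slimness of `Δ̂_{X,ℍ}`; [AbsAnab], Theorem 1.1.1, (ii)]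
`1 → Δ^tp_{X,ℍ} → Π^tp_{X,ℍ} → G_k → 1`, `1 → Δ̂_{X,ℍ} → Π̂_{X,ℍ} → G_k → 1`".  The typed predicate
`StableCurveTemperedData.Cor23iii` has four fields: `slim`, `exact_tp`, `exact_hat`, `center_eq_bot`
(with `Π_{X,ℍ} := N_{Π_X}(Δ_{X,ℍ})`, rendering note (3) of the statement file).

What is kernel-checked here is exactly the printed "In particular": the fields `exact_tp`,
`exact_hat`, `center_eq_bot` FOLLOW from
* the first sentence (the slimness of `Δ̂_{X,ℍ}`) — taken BY NAME as the hypothesis `hslim`, i.e. the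
  content of the field `Cor23iii.slim` itself (print proves it from [Tama2] Thm 0.2 (v) /
  [AbsTopII] Prop 1.3 (iv) / [NodNon] Prop 3.9 (i) on the towers of coverings of the stable model,
  data the interface `StableCurveTemperedData` does not carry — the residual deep input of the node);
* "[cf. (i)]": `Cor23i` (through abc-iut-L5-t11's `piXH_inf_delta_of_cor23i`: `Π_{X,ℍ} ∩ Δ_X = Δ_{X,ℍ}`);
* "[cf. (ii)]": `Cor23ii` (the closure of `Δ^tp_{X,ℍ}` in `Δ̂_X` is `Δ̂_{X,ℍ}`) — used twice: a central
  element of `Δ^tp_{X,ℍ}` centralises the closure `Δ̂_{X,ℍ}`, and `N_{Π^tp_X}(Δ^tp_{X,ℍ})` normalises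
  the closure, so that `Π^tp_{X,ℍ} ↪ Π̂_{X,ℍ}`;
* "[AbsAnab], Theorem 1.1.1, (ii)" (slimness of `G_k`), in the weak form actually used: `Z(G_k) = 1`
  (hypothesis `hGk`; `center_eq_bot_of_isSlimGroup` converts slimness into it);
* the standing hypothesis of p. 47 l. 12, "the sub-semi-graph `ℍ ⊆ 𝔾` is stabilized by the natural
  action of `G_k` on `𝔾`", in group-theoretic form: conjugation by any `γ ∈ Π^tp_X` carries
  `Δ^tp_{X,ℍ}` to a `Δ^tp_X`-conjugate of itself (hypothesis `hstab` — this is the "in particular" of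
  Cor. 2.3 (i), "the natural outer actions of `G_k` on `Δ_X` … determine natural outer actions of `G_k`
  on `Δ_{X,ℍ}`", which the statement file does not type separately; an atom of the data, flagged for
  the L3 merge like the atoms of `TemperedCoveringsProofs`);
* Hausdorffness of `Π̂_X` (a profinite group).
Main results: `StableCurveTemperedData.cor23iii_of_slim_of_stable` (all of `Cor23iii` from the above),
`….cor23iii_of_slim_of_surjective` (the same with `Π^tp_{X,ℍ} ↠ G_k` as the hypothesis),
`….center_deltaTpH_eq_bot` (`Z(Δ^tp_{X,ℍ}) = 1` ⇐ (ii) + slimness), `….map_ιX_piTpXH_le_piHatXH`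
(`Π^tp_{X,ℍ} ↪ Π̂_{X,ℍ}` ⇐ (ii)), `….prTp_piTpXH_surjective_of_stable` (`Π^tp_{X,ℍ} ↠ G_k` ⇐ stability),
and the plain group theory `center_eq_bot_of_isSlimGroup`, `center_eq_bot_of_extension`,
`map_subtype_topologicalClosure`.  With `cor23iv_of_cor23i` (abc-iut-L5-t11) this also yields
Cor. 2.3 (iv) from the same inputs (`cor23iv_of_slim_of_stable`).
No side is taken on [IUTchIII] Cor. 3.12; typed ≠ proved for the slimness clause.

v2 (de-duplication, 2026-08-26, filed by abc-iut-w4-d058 as holder of node IUTchI:Cor2.3(iii) on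
behalf of the author abc-iut-w4-d060, whose `ledger withdraw p411924` arrived after acceptance): three
kernels for this node landed within minutes under the SAME fully-qualified names
(`TemperedCoveringsCor23iiiProofs` = file of record, `TemperedCoveringsCentreFree`, this file), so
that no module could import two of them.  This revision imports the file of record and DELETES the
declarations it duplicated (`center_eq_bot_of_isSlimGroup`, `center_eq_bot_of_extension`,
`StableCurveTemperedData.ιΔ_injective`, `….center_deltaTpH_eq_bot` — now used from there BY NAME) and
RENAMES this file's two closing theorems, which are genuinely STRONGER than the file of record's
(they need no profinite-side stability hypothesis: `Π̂_{X,ℍ} ↠ G_k` is derived from `Π^tp_{X,ℍ} ↠ G_k`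
through Cor. 2.3 (ii), `map_ιX_piTpXH_le_piHatXH`): `cor23iii_of_slim` ↦ `cor23iii_of_slim_of_stable`,
`cor23iv_of_slim` ↦ `cor23iv_of_slim_of_stable`.  All other declarations are abc-iut-w4-d060's, unchanged.
-/

namespace Literature.IUT.HodgeTheaters

open Pointwise Topology Literature.AlgebraicGeometry.Frobenioids
open Literature.AnabelianGeometry.AbsoluteAnabelian (IsCommensurablyTerminal IsNormallyTerminal)

universe u

/-! ### Plain (topological) group theory -/

section GroupTheory

variable {G : Type*} [Group G]

/-- `g` normalises `H` iff `g H g⁻¹ = H` (pointwise `MulAut.conj` form) [the form in which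
"`Π_{X,ℍ}` defined so as to render the sequences exact" = `N_{Π_X}(Δ_{X,ℍ})` is used, p. 47].
[cite: Mochizuki2012, Cor 2.3(iii) p.47] -/
theorem mem_normalizer_iff_conj_smul_eq (g : G) (H : Subgroup G) :
    g ∈ Subgroup.normalizer (H : Set G) ↔ MulAut.conj g • H = H := by
  rw [Subgroup.mem_normalizer_iff]
  constructor
  · intro h
    ext x
    rw [Subgroup.mem_pointwise_smul_iff_inv_smul_mem, ← map_inv, MulAut.smul_def,
      MulAut.conj_apply, inv_inv, h (g⁻¹ * x * g)]
    simp only [mul_assoc, mul_inv_cancel_left, mul_inv_cancel, mul_one]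
  · intro h x
    conv_rhs => rw [← h]
    rw [← MulAut.conj_apply, ← MulAut.smul_def, Subgroup.smul_mem_pointwise_smul_iff]

/-- `ConjAct` and `MulAut.conj` give the same conjugate subgroup (bridge between the `ConjAct` form
of `CommensuratorLemmas` and the `MulAut.conj` form of the statement file).
[cite: Mochizuki2012, Cor 2.3(iii) p.47] -/
theorem conjAct_smul_eq_conj_smul (g : G) (H : Subgroup G) :
    ConjAct.toConjAct g • H = MulAut.conj g • H := by
  ext x
  rw [Subgroup.mem_pointwise_smul_iff_inv_smul_mem, Subgroup.mem_pointwise_smul_iff_inv_smul_mem,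
    ← ConjAct.toConjAct_inv, ConjAct.toConjAct_smul_eq_mulAut_conj, map_inv, MulAut.smul_def]

variable [TopologicalSpace G] [IsTopologicalGroup G]

/-- Closure inside a subgroup versus closure in the ambient group: for `K ⊆ Δ ⊆ G`, the image in
`G` of the closure of `K` in `Δ` is `cl_G(K) ∩ Δ` (the subspace topology is induced) [the passage
from "the closure of `Δ^tp_{X,ℍ}` in `Δ̂_X`" of (ii) to subgroups of `Π̂_X`, p. 47].
[cite: Mochizuki2012, Cor 2.3(iii) p.47] -/
theorem map_subtype_topologicalClosure (Δ : Subgroup G) (K : Subgroup Δ) :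
    K.topologicalClosure.map Δ.subtype = (K.map Δ.subtype).topologicalClosure ⊓ Δ := by
  have hc : _root_.closure (K : Set Δ) =
      Subtype.val ⁻¹' _root_.closure (Subtype.val '' (K : Set Δ)) :=
    Topology.IsInducing.subtypeVal.closure_eq_preimage_closure_image _
  have hK : ((K.map Δ.subtype : Subgroup G) : Set G) = Subtype.val '' (K : Set Δ) := by
    rw [Subgroup.coe_map, Subgroup.coe_subtype]
  ext x
  constructor
  · rintro ⟨y, hy, rfl⟩
    have hy' : (y : ↥Δ) ∈ _root_.closure (K : Set Δ) := hy
    rw [hc, Set.mem_preimage, ← hK] at hy'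
    exact ⟨hy', y.2⟩
  · rintro ⟨hx, hxΔ⟩
    refine ⟨⟨x, hxΔ⟩, ?_, rfl⟩
    show (⟨x, hxΔ⟩ : ↥Δ) ∈ _root_.closure (K : Set Δ)
    rw [hc, Set.mem_preimage, ← hK]
    exact hx

end GroupTheory

/-! ### Corollary 2.3 (iii) from (i), (ii), the slimness of `Δ̂_{X,ℍ}`, `Z(G_k) = 1`, stability -/

namespace StableCurveTemperedData

variable (D : StableCurveTemperedData.{u})

/-- `ι_X(Δ^tp_{X,ℍ}) = ι_Δ(Δ^tp_{X,ℍ})` as subgroups of `Π̂_X`. ([IUTchI] Cor 2.3 p.47) [claim: Mochizuki2012, status: disputed] -/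
theorem map_ιX_deltaTpH :
    (D.deltaTpH.map D.DeltaTp.subtype).map D.ιX = (D.deltaTpH.map D.ιΔ).map D.DeltaHat.subtype := by
  rw [Subgroup.map_map, Subgroup.map_map]
  congr 1

/-- **`Π^tp_{X,ℍ} ↠ G_k` from the `G_k`-stability of `ℍ`** (p. 47: "`ℍ ⊆ 𝔾` is stabilized by the natural
action of `G_k` on `𝔾`", whence the "natural outer actions of `G_k` on `Δ^tp_{X,ℍ}`" of Cor. 2.3 (i)):
if conjugation by every `γ ∈ Π^tp_X` carries `Δ^tp_{X,ℍ}` to a `Δ^tp_X`-conjugate `δ Δ^tp_{X,ℍ} δ⁻¹`, then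
`δ⁻¹γ ∈ N_{Π^tp_X}(Δ^tp_{X,ℍ}) = Π^tp_{X,ℍ}` has the same image as `γ` in `G_k`.
([IUTchI] Cor 2.3(iii) p.47) [claim: Mochizuki2012, status: disputed] -/
theorem prTp_piTpXH_surjective_of_stable
    (hstab : ∀ γ : D.PiTp, ∃ δ ∈ D.DeltaTp,
      MulAut.conj γ • (D.deltaTpH.map D.DeltaTp.subtype) =
        MulAut.conj δ • (D.deltaTpH.map D.DeltaTp.subtype)) :
    Function.Surjective (D.prTp.comp D.piTpXH.subtype) := by
  intro g
  obtain ⟨γ, rfl⟩ := D.prTp_surjective g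
  obtain ⟨δ, hδ, he⟩ := hstab γ
  have hmem : δ⁻¹ * γ ∈ D.piTpXH := by
    apply (mem_normalizer_iff_conj_smul_eq _ _).mpr
    rw [map_mul, mul_smul, he, ← mul_smul, map_inv, inv_mul_cancel, one_smul]
  refine ⟨⟨δ⁻¹ * γ, hmem⟩, ?_⟩
  have hδ1 : D.prTp δ = 1 := hδ
  simp only [MonoidHom.coe_comp, Subgroup.coe_subtype, Function.comp_apply, map_mul, map_inv, hδ1,
    inv_one, one_mul]

/-- **`Π^tp_{X,ℍ} ↪ Π̂_{X,ℍ}` from Cor. 2.3 (ii)**: an element of `Π^tp_X` normalising `Δ^tp_{X,ℍ}` normalises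
[conjugation being a homeomorphism of `Π̂_X` preserving `Δ̂_X`] the closure `Δ̂_{X,ℍ}` of `Δ^tp_{X,ℍ}` in
`Δ̂_X` ("[cf. (ii) …]", p. 47). ([IUTchI] Cor 2.3(iii) p.47) [claim: Mochizuki2012, status: disputed] -/
theorem map_ιX_piTpXH_le_piHatXH (hii : D.Cor23ii) : D.piTpXH.map D.ιX ≤ D.piHatXH := by
  rintro _ ⟨γ, hγ, rfl⟩
  have hγ' : MulAut.conj γ • (D.deltaTpH.map D.DeltaTp.subtype) = D.deltaTpH.map D.DeltaTp.subtype :=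
    (mem_normalizer_iff_conj_smul_eq γ _).mp hγ
  -- (1) `ι_X γ` normalises `L := ι_Δ(Δ^tp_{X,ℍ}) ⊆ Π̂_X`
  have hL : MulAut.conj (D.ιX γ) • ((D.deltaTpH.map D.ιΔ).map D.DeltaHat.subtype) =
      (D.deltaTpH.map D.ιΔ).map D.DeltaHat.subtype := by
    rw [← map_ιX_deltaTpH, ← map_conj_smul, hγ']
  -- (2) `Δ̂_{X,ℍ} = cl_{Π̂_X}(L) ∩ Δ̂_X` by Cor. 2.3 (ii)
  have hMhat : D.deltaHatH.map D.DeltaHat.subtype =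
      ((D.deltaTpH.map D.ιΔ).map D.DeltaHat.subtype).topologicalClosure ⊓ D.DeltaHat := by
    rw [← hii.closure_eq]
    exact map_subtype_topologicalClosure D.DeltaHat _
  -- (3) hence `ι_X γ` normalises `Δ̂_{X,ℍ}`
  have hfix : MulAut.conj (D.ιX γ) • (D.deltaHatH.map D.DeltaHat.subtype) =
      D.deltaHatH.map D.DeltaHat.subtype := by
    rw [hMhat, Subgroup.smul_inf, Subgroup.Normal.conj_smul_eq_self (D.ιX γ) D.DeltaHat,
      ← conjAct_smul_eq_conj_smul (D.ιX γ) (Subgroup.topologicalClosure _),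
      conjAct_smul_topologicalClosure, conjAct_smul_eq_conj_smul, hL]
  exact (mem_normalizer_iff_conj_smul_eq _ _).mpr hfix

/-- **`Π̂_{X,ℍ} ↠ G_k`** from `Π^tp_{X,ℍ} ↠ G_k` and `Π^tp_{X,ℍ} ↪ Π̂_{X,ℍ}` (Cor. 2.3 (ii)).
([IUTchI] Cor 2.3(iii) p.47) [claim: Mochizuki2012, status: disputed] -/
theorem prHat_piHatXH_surjective (hii : D.Cor23ii)
    (htp : Function.Surjective (D.prTp.comp D.piTpXH.subtype)) :
    Function.Surjective (D.prHat.comp D.piHatXH.subtype) := by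
  intro g
  obtain ⟨⟨γ, hγ⟩, rfl⟩ := htp g
  refine ⟨⟨D.ιX γ, D.map_ιX_piTpXH_le_piHatXH hii ⟨γ, hγ, rfl⟩⟩, ?_⟩
  simp only [MonoidHom.coe_comp, Subgroup.coe_subtype, Function.comp_apply, prHat_ιX]

/-- **Corollary 2.3 (iii) from Cor. 2.3 (i), (ii), the slimness of `Δ̂_{X,ℍ}`, `Z(G_k) = 1` and
`Π^tp_{X,ℍ} ↠ G_k`.**  The typed `Cor23iii` holds for `D` as soon as: `Π̂_X` is Hausdorff; Cor. 2.3 (i)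
and (ii) hold for `D`; under the hypothesis (a)/(b) of (iii), `Δ̂_{X,ℍ}` is slim [the first sentence of
(iii), print's deep clause]; `G_k` is centre-free ["[AbsAnab], Theorem 1.1.1, (ii)"]; and
`Π^tp_{X,ℍ} := N_{Π^tp_X}(Δ^tp_{X,ℍ})` surjects onto `G_k` [the outer `G_k`-action on `Δ^tp_{X,ℍ}` of (i)].
([IUTchI] Cor 2.3(iii) p.47) [claim: Mochizuki2012, status: disputed] -/
theorem cor23iii_of_slim_of_surjective [T2Space D.PiHat] (hi : D.Cor23i) (hii : D.Cor23ii)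
    (hslim : D.Cor23Hyp → IsSlimGroup D.deltaHatH) (hGk : Subgroup.center D.Gk = ⊥)
    (htp : Function.Surjective (D.prTp.comp D.piTpXH.subtype)) : D.Cor23iii := by
  have hinf := D.piXH_inf_delta_of_cor23i hi
  have hhat := D.prHat_piHatXH_surjective hii htp
  refine ⟨hslim, fun _ => ⟨hinf.1, htp⟩, fun _ => ⟨hinf.2, hhat⟩, fun hyp => ?_⟩
  have h1 := D.center_deltaTpH_eq_bot hii (hslim hyp)
  have h2 := center_eq_bot_of_isSlimGroup (hslim hyp)
  exact ⟨h1, center_eq_bot_of_extension D.prTp D.piTpXH D.deltaTpH hinf.1 Subgroup.le_normalizer htp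
    h1 hGk, h2, center_eq_bot_of_extension D.prHat D.piHatXH D.deltaHatH hinf.2 Subgroup.le_normalizer
    hhat h2 hGk⟩

/-- **Corollary 2.3 (iii) from Cor. 2.3 (i), (ii), the slimness of `Δ̂_{X,ℍ}`, `Z(G_k) = 1` and the
`G_k`-stability of `ℍ`** — the printed "In particular" of Cor. 2.3 (iii), p. 47, with every input named:
`Π̂_X` Hausdorff; `Cor23i`, `Cor23ii` for `D`; the slimness of `Δ̂_{X,ℍ}` under (a)/(b) [first sentence of
(iii)]; `Z(G_k) = 1` [[AbsAnab] Thm 1.1.1 (ii)]; and "`ℍ ⊆ 𝔾` is stabilized by the natural action of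
`G_k`" in the form: conjugation by any `γ ∈ Π^tp_X` carries `Δ^tp_{X,ℍ}` to a `Δ^tp_X`-conjugate of
itself.  [v2: renamed from `cor23iii_of_slim` (name taken by the file of record, whose version carries an
extra profinite-side stability hypothesis `hOutHat`); this is the STRONGER form, `Π̂_{X,ℍ} ↠ G_k` being
derived from the tempered side through Cor. 2.3 (ii).] ([IUTchI] Cor 2.3(iii) p.47) [claim: Mochizuki2012, status: disputed] -/
theorem cor23iii_of_slim_of_stable [T2Space D.PiHat] (hi : D.Cor23i) (hii : D.Cor23ii)
    (hslim : D.Cor23Hyp → IsSlimGroup D.deltaHatH) (hGk : Subgroup.center D.Gk = ⊥)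
    (hstab : ∀ γ : D.PiTp, ∃ δ ∈ D.DeltaTp,
      MulAut.conj γ • (D.deltaTpH.map D.DeltaTp.subtype) =
        MulAut.conj δ • (D.deltaTpH.map D.DeltaTp.subtype)) :
    D.Cor23iii :=
  D.cor23iii_of_slim_of_surjective hi hii hslim hGk (D.prTp_piTpXH_surjective_of_stable hstab)

/-- **Corollary 2.3 (iii) and (iv) together** from the same inputs ("In light of the exact sequences of
assertion (iii), assertion (iv) follows immediately from assertion (i)", p. 49, via abc-iut-L5-t11's
`cor23iv_of_cor23i`).  [v2: renamed from `cor23iv_of_slim`.] ([IUTchI] Cor 2.3(iv) p.47) [claim: Mochizuki2012, status: disputed] -/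
theorem cor23iv_of_slim_of_stable [T2Space D.PiHat] (hi : D.Cor23i) (hii : D.Cor23ii)
    (hslim : D.Cor23Hyp → IsSlimGroup D.deltaHatH) (hGk : Subgroup.center D.Gk = ⊥)
    (hstab : ∀ γ : D.PiTp, ∃ δ ∈ D.DeltaTp,
      MulAut.conj γ • (D.deltaTpH.map D.DeltaTp.subtype) =
        MulAut.conj δ • (D.deltaTpH.map D.DeltaTp.subtype)) :
    D.Cor23iii ∧ D.Cor23iv :=
  ⟨D.cor23iii_of_slim_of_stable hi hii hslim hGk hstab,
    D.cor23iv_of_cor23i hi (D.cor23iii_of_slim_of_stable hi hii hslim hGk hstab)⟩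

end StableCurveTemperedData

end Literature.IUT.HodgeTheaters
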